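import Summits.MatrixMultiplication.OmegaCensus.STPPVosperSlackOneBetaCoverR

/-!
# ω-census (abelian STPP census): case-β rows (run certificates) for `{(2,3,3),(2,3,4),(3,3,2)} ⊆ ℤ₅₉` (kernel computation)

HONEST FRAMING (pub-omega census; verbatim): lottery ticket; floor = certified bounds/negative ranges.
Census STRUCTURE (seat pub-omega-stpp-1 gen 31, 2026-08-28), family (b2).  All `59` rows of `bCoverRowR 59 41 16 4 {0, ±1, ±2, ±3} 15 [(2,3,3),(3,2,3)]
certs` for the pattern `{(2,3,3),(2,3,4),(3,3,2)}` at `59` (reading `(a,b,c) = (2,4,3)` at the `(2,3,4)` block of `(−A, −C, −B)`; `n + 1 = 41`, `m = 16`,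
`b = 4`, `L = 15`), ONE `decide +kernel` (≈ 25 s).  The βHR survivors are the ratios `j ∈ {29, 30} = ±2⁻¹` (hole `hh ∈ {8, 12, …, 32}`, `g₀ = 3`), all with
the Z-point list `{0, 45, …, 58}` = the cyclic window `[45, 45 + 15)` and the Y-points `{29 k}` resp. `{30 k}`, `k < 15`, = two runs of `8` and `7` points at
cyclic distance `23`; the run certificates `(45, 15, [(52, 8), (23, 7)])` (for `j = 29`) and `(45, 15, [(0, 8), (30, 7)])` (for `j = 30`) kill them
(`8 ∉ {3 m₁ + 3 m₂}`), so the exact-cover search is never evaluated.  Assembled in `STPPVosperSlackOneCoverKillsZ59.lean`.  Pure finite computation;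
nothing here is progress on `ω`.  Python mirror: HOME `pub-omega-stpp-1-g31/code/pilot_beta_233_234_332.py`.
-/

open Finset

namespace Summit.MatrixMultiplication.OmegaCensus.CubeNB

set_option maxHeartbeats 4000000 in
/-- All rows of `bCoverRowR 59 41 16 4 {0, ±1, ±2, ±3} 15 [(2,3,3),(3,2,3)] certs` (list form), with the two run certificates
`(45, 15, [(52, 8), (23, 7)])` (Z-window `[45, 45+15)`, Y-runs `{52..58, 0} ∪ {23..29}`, ratio `29`) and `(45, 15, [(0, 8), (30, 7)])` (ratio `30`). [folklore] -/
theorem bCoverRowR_59_233234332_rows :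
    ((List.range 59).all (bCoverRowR 59 41 16 4 {0, 1, 58, 2, 57, 3, 56} 15 [(2, 3, 3), (3, 2, 3)] [(45, 15, [(52, 8), (23, 7)]), (45, 15, [(0, 8), (30, 7)])])) = true := by
  decide +kernel

/-- **All rows of the case-β table (run-certificate form) for `{(2,3,3),(2,3,4),(3,3,2)} ⊆ ℤ₅₉`.** [folklore] -/
theorem bCoverRowR_59_233234332_all :
    ∀ j < 59, bCoverRowR 59 41 16 4 {0, 1, 58, 2, 57, 3, 56} 15 [(2, 3, 3), (3, 2, 3)]
      [(45, 15, [(52, 8), (23, 7)]), (45, 15, [(0, 8), (30, 7)])] j = true :=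
  fun j hj => List.all_eq_true.1 bCoverRowR_59_233234332_rows j (List.mem_range.2 hj)

end Summit.MatrixMultiplication.OmegaCensus.CubeNB
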